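import Literature.MathematicalPhysics.QuantumFieldTheory.LatticeLangevinDynamics
import Mathlib.Analysis.SpecificLimits.Basic
import Mathlib.Data.ZMod.ValMinAbs
import Mathlib.Data.Pi.Interval
import HarnessLib

/-!
# Route `ColdStartUniversality` (fixed-cut-off SZZ dynamics; LIEB–ROBINSON / LOCALITY package, file 6):
# torus geometry for the light cone — the sup-distance on `(ℤ/L)³`, admissible exponential weights, ball counts and tail sums

Helper file (seat `ym-line-csu-p1`, g30; `--supports stmt-QuantumFields-24809`).  Elementary lattice bookkeeping for the locality estimates of the
Lieb–Robinson package, on the torus `(ℤ/L)³` with the cyclic distance `|·|_L` (`ZMod.valMinAbs`) and the sup-distance of base points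
`D(x, y) = max_i |y_i − x_i|_L` (links are compared through their base points; written out in every statement, no definition):
* `natAbs_valMinAbs_add_le'`, `torusDist_add_le_succ` — `D` changes by at most `1` under a unit step of any coordinates, hence
  ★ `weight_pow_torusDist_admissible`: the exponential weight `w_f = K^{D(x₀, f)}` (`K ≥ 1`) satisfies the plaquette log-Lipschitz condition
  `w_e ≤ K·w_f` of `weighted_dossSussmannField_lipschitz` / `pathwise_liebRobinson` / `transitionKernel_liebRobinson`;
* ★ `card_torusBall_le` — `#{y : D(x,y) ≤ R} ≤ (2R+1)³` (injection into a cube of `ℤ³` by `valMinAbs`); `card_edge_torusBall_le` — `≤ 3(2R+1)³` links;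
* ★ `sum_pow_torusDist_le` — `Σ_y 54^{−D(x,y)} ≤ 2` and `sum_edge_pow_torusDist_le` — `Σ_f 54^{−D(x,f)} ≤ 6`, VOLUME-FREE (shells of radius `d` have
  at most `(2d+1)³ ≤ 27^d` points); hence ★★ `sum_edge_min_le` — for `a, B ≥ 0` and every `R`:
  `Σ_f min(a·108^{−D(x,f)}, B) ≤ 3(2R+1)³·B + 6a·2^{−(R+1)}` — the «inside / outside the light cone» split used by the every-start local mixing theorem.
THEOREMS ONLY, no definition, no sorry; all [folklore].  HONEST FRAMING: lattice combinatorics; nothing about Yang–Mills by itself; nothing `K`-uniform;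
the Yang–Mills mass gap is NOT proved.
-/

set_option autoImplicit false

noncomputable section

namespace Summit.QuantumFields.YangMills.Theorems.ColdStartUniversality.LiebRobinson

open Finset
open scoped BigOperators
open Literature.MathematicalPhysics.QuantumFieldTheory

variable {L : ℕ} [NeZero L]

/-! ## §1. The cyclic distance under unit steps -/

/-- `|m mod L|_L ≤ |m|`: the cyclic representative is the shortest. [folklore] -/
theorem natAbs_valMinAbs_intCast_le (m : ℤ) : (((m : ZMod L)).valMinAbs).natAbs ≤ m.natAbs :=
  ZMod.natAbs_min_of_le_div_two L _ _ (by rw [ZMod.coe_valMinAbs]) (ZMod.natAbs_valMinAbs_le _)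

omit [NeZero L] in
/-- Triangle inequality for the cyclic size: `|a + b|_L ≤ |a|_L + |b|_L`. [folklore] -/
theorem natAbs_valMinAbs_add_le' (a b : ZMod L) :
    ((a + b).valMinAbs).natAbs ≤ (a.valMinAbs).natAbs + (b.valMinAbs).natAbs :=
  (ZMod.natAbs_valMinAbs_add_le a b).trans (Int.natAbs_add_le _ _)

/-- `|1|_L ≤ 1`. [folklore] -/
theorem natAbs_valMinAbs_one_le : (((1 : ZMod L)).valMinAbs).natAbs ≤ 1 := by
  have h := natAbs_valMinAbs_intCast_le (L := L) 1
  rwa [Int.cast_one] at h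

/-- `|−1|_L ≤ 1`. [folklore] -/
theorem natAbs_valMinAbs_neg_one_le : (((-1 : ZMod L)).valMinAbs).natAbs ≤ 1 := by
  rw [ZMod.natAbs_valMinAbs_neg]; exact natAbs_valMinAbs_one_le

/-- A coordinate of `Pi.single μ 1` has cyclic size `≤ 1`. [folklore] -/
theorem natAbs_valMinAbs_single_le (μ i : Fin 3) : (((Pi.single μ (1 : ZMod L) : Fin 3 → ZMod L) i).valMinAbs).natAbs ≤ 1 := by
  by_cases h : i = μ
  · subst h; rw [Pi.single_eq_same]; exact natAbs_valMinAbs_one_le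
  · rw [Pi.single_eq_of_ne h, ZMod.valMinAbs_zero]; simp

/-- A coordinate of `−Pi.single μ 1` has cyclic size `≤ 1`. [folklore] -/
theorem natAbs_valMinAbs_neg_single_le (μ i : Fin 3) : (((-(Pi.single μ (1 : ZMod L) : Fin 3 → ZMod L)) i).valMinAbs).natAbs ≤ 1 := by
  rw [Pi.neg_apply, ZMod.natAbs_valMinAbs_neg]; exact natAbs_valMinAbs_single_le μ i

/-- A coordinate of `Pi.single μ 1 − Pi.single j 1` (`j ≠ μ`) has cyclic size `≤ 1`. [folklore] -/
theorem natAbs_valMinAbs_single_sub_single_le {μ j : Fin 3} (hj : j ≠ μ) (i : Fin 3) :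
    (((Pi.single μ (1 : ZMod L) - Pi.single j (1 : ZMod L) : Fin 3 → ZMod L) i).valMinAbs).natAbs ≤ 1 := by
  rw [Pi.sub_apply]
  by_cases h1 : i = μ
  · subst h1
    rw [Pi.single_eq_same, Pi.single_eq_of_ne (Ne.symm hj), sub_zero]; exact natAbs_valMinAbs_one_le
  · rw [Pi.single_eq_of_ne h1, zero_sub]
    by_cases h2 : i = j
    · subst h2; rw [Pi.single_eq_same]; exact natAbs_valMinAbs_neg_one_le
    · rw [Pi.single_eq_of_ne h2, neg_zero, ZMod.valMinAbs_zero]; simp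

/-! ## §2. The sup-distance of base points: unit steps and the admissible exponential weight -/

omit [NeZero L] in
/-- ★ **Unit steps move the sup-distance by at most one**: if every coordinate of `u` has cyclic size `≤ 1` then
`D(x, y + u) ≤ D(x, y) + 1`, `D(x,y) = max_i |y_i − x_i|_L`. [folklore] -/
theorem torusDist_add_le_succ (x y u : Literature.MathematicalPhysics.QuantumFieldTheory.Site 3 L)
    (hu : ∀ i, ((u i).valMinAbs).natAbs ≤ 1) :
    (Finset.univ.sup fun i : Fin 3 => (((y + u) i - x i).valMinAbs).natAbs) ≤
      (Finset.univ.sup fun i : Fin 3 => ((y i - x i).valMinAbs).natAbs) + 1 := by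
  refine Finset.sup_le fun i _ => ?_
  have h1 : (y + u) i - x i = (y i - x i) + u i := by rw [Pi.add_apply]; ring
  rw [h1]
  calc (((y i - x i) + u i).valMinAbs).natAbs ≤ ((y i - x i).valMinAbs).natAbs + ((u i).valMinAbs).natAbs :=
        natAbs_valMinAbs_add_le' _ _
    _ ≤ (Finset.univ.sup fun i : Fin 3 => ((y i - x i).valMinAbs).natAbs) + 1 :=
        add_le_add (Finset.le_sup (f := fun i : Fin 3 => ((y i - x i).valMinAbs).natAbs) (Finset.mem_univ i)) (hu i)

omit [NeZero L] in
/-- `D(x, y) ≤ D(x, y + u) + 1` for a unit step `u` (apply the previous lemma to `−u`). [folklore] -/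
theorem torusDist_le_add_succ (x y u : Literature.MathematicalPhysics.QuantumFieldTheory.Site 3 L)
    (hu : ∀ i, ((u i).valMinAbs).natAbs ≤ 1) :
    (Finset.univ.sup fun i : Fin 3 => ((y i - x i).valMinAbs).natAbs) ≤
      (Finset.univ.sup fun i : Fin 3 => (((y + u) i - x i).valMinAbs).natAbs) + 1 := by
  have h := torusDist_add_le_succ x (y + u) (-u) (fun i => by rw [Pi.neg_apply, ZMod.natAbs_valMinAbs_neg]; exact hu i)
  rwa [add_neg_cancel_right] at h

omit [NeZero L] in
/-- `D(x, x) = 0`. [folklore] -/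
theorem torusDist_self (x : Literature.MathematicalPhysics.QuantumFieldTheory.Site 3 L) :
    (Finset.univ.sup fun i : Fin 3 => ((x i - x i).valMinAbs).natAbs) = 0 := by
  refine le_antisymm (Finset.sup_le fun i _ => ?_) (Nat.zero_le _)
  rw [sub_self, ZMod.valMinAbs_zero]; simp

omit [NeZero L] in
/-- `D` is symmetric. [folklore] -/
theorem torusDist_comm (x y : Literature.MathematicalPhysics.QuantumFieldTheory.Site 3 L) :
    (Finset.univ.sup fun i : Fin 3 => ((y i - x i).valMinAbs).natAbs) =
      (Finset.univ.sup fun i : Fin 3 => ((x i - y i).valMinAbs).natAbs) := by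
  refine Finset.sup_congr rfl fun i _ => ?_
  rw [← neg_sub, ZMod.natAbs_valMinAbs_neg]

/-- ★ **The exponential weight `w_f = K^{D(x₀, f)}` is admissible** (`K ≥ 1`): it satisfies the plaquette log-Lipschitz condition of
`weighted_dossSussmannField_lipschitz` — for every link `e = (y, μ)` and transverse direction `j ≠ μ`, the six non-root links of the two
plaquettes through `e` in the plane `{μ, j}` have base points one unit step away from `y`. [folklore] -/
theorem weight_pow_torusDist_admissible (x₀ : Literature.MathematicalPhysics.QuantumFieldTheory.Site 3 L) {K : ℝ} (hK : 1 ≤ K) :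
    ∀ (e : Edge 3 L) (j : Fin 3), j ≠ e.2 →
      K ^ (Finset.univ.sup fun i : Fin 3 => ((e.1 i - x₀ i).valMinAbs).natAbs) ≤
          K * K ^ (Finset.univ.sup fun i : Fin 3 => (((e.1.shift e.2) i - x₀ i).valMinAbs).natAbs) ∧
      K ^ (Finset.univ.sup fun i : Fin 3 => ((e.1 i - x₀ i).valMinAbs).natAbs) ≤
          K * K ^ (Finset.univ.sup fun i : Fin 3 => (((e.1.shift j) i - x₀ i).valMinAbs).natAbs) ∧
      K ^ (Finset.univ.sup fun i : Fin 3 => ((e.1 i - x₀ i).valMinAbs).natAbs) ≤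
          K * K ^ (Finset.univ.sup fun i : Fin 3 => ((e.1 i - x₀ i).valMinAbs).natAbs) ∧
      K ^ (Finset.univ.sup fun i : Fin 3 => ((e.1 i - x₀ i).valMinAbs).natAbs) ≤
          K * K ^ (Finset.univ.sup fun i : Fin 3 => ((((e.1 - Pi.single j 1).shift e.2) i - x₀ i).valMinAbs).natAbs) ∧
      K ^ (Finset.univ.sup fun i : Fin 3 => ((e.1 i - x₀ i).valMinAbs).natAbs) ≤
          K * K ^ (Finset.univ.sup fun i : Fin 3 => (((e.1 - Pi.single j 1 : Literature.MathematicalPhysics.QuantumFieldTheory.Site 3 L) i - x₀ i).valMinAbs).natAbs) ∧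
      K ^ (Finset.univ.sup fun i : Fin 3 => ((e.1 i - x₀ i).valMinAbs).natAbs) ≤
          K * K ^ (Finset.univ.sup fun i : Fin 3 => (((e.1 - Pi.single j 1 : Literature.MathematicalPhysics.QuantumFieldTheory.Site 3 L) i - x₀ i).valMinAbs).natAbs) := by
  intro e j hj
  have hK0 : 0 ≤ K := zero_le_one.trans hK
  -- generic step: `D(x₀, y) ≤ D(x₀, y + u) + 1` gives `K^D(y) ≤ K · K^D(y+u)`
  have step : ∀ (u : Literature.MathematicalPhysics.QuantumFieldTheory.Site 3 L), (∀ i, ((u i).valMinAbs).natAbs ≤ 1) →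
      K ^ (Finset.univ.sup fun i : Fin 3 => ((e.1 i - x₀ i).valMinAbs).natAbs) ≤
        K * K ^ (Finset.univ.sup fun i : Fin 3 => (((e.1 + u) i - x₀ i).valMinAbs).natAbs) := by
    intro u hu
    rw [← pow_succ']
    exact pow_le_pow_right₀ hK (torusDist_le_add_succ x₀ e.1 u hu)
  have hshift : ∀ (y : Literature.MathematicalPhysics.QuantumFieldTheory.Site 3 L) (i : Fin 3), y.shift i = y + Pi.single i 1 :=
    fun y i => rfl
  refine ⟨?_, ?_, ?_, ?_, ?_, ?_⟩
  · rw [hshift]; exact step _ (natAbs_valMinAbs_single_le e.2)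
  · rw [hshift]; exact step _ (natAbs_valMinAbs_single_le j)
  · have h := step 0 (fun i => by rw [Pi.zero_apply, ZMod.valMinAbs_zero]; simp)
    rwa [add_zero] at h
  · have h := step (Pi.single e.2 1 - Pi.single j 1) (natAbs_valMinAbs_single_sub_single_le hj)
    have heq : e.1 + (Pi.single e.2 1 - Pi.single j 1) = (e.1 - Pi.single j 1).shift e.2 := by
      rw [hshift]; abel
    rwa [heq] at h
  · have h := step (-(Pi.single j 1)) (natAbs_valMinAbs_neg_single_le j)
    rwa [← sub_eq_add_neg] at h
  · have h := step (-(Pi.single j 1)) (natAbs_valMinAbs_neg_single_le j)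
    rwa [← sub_eq_add_neg] at h

/-! ## §3. Ball counts -/

/-- ★ **Balls of the sup-distance are small**: `#{y : D(x,y) ≤ R} ≤ (2R+1)³` (the map `y ↦ (valMinAbs (y_i − x_i))_i` is injective into the
cube `[−R, R]³ ⊆ ℤ³`). [folklore] -/
theorem card_torusBall_le (x : Literature.MathematicalPhysics.QuantumFieldTheory.Site 3 L) (R : ℕ) :
    (Finset.univ.filter fun y : Literature.MathematicalPhysics.QuantumFieldTheory.Site 3 L =>
        (Finset.univ.sup fun i : Fin 3 => ((y i - x i).valMinAbs).natAbs) ≤ R).card ≤ (2 * R + 1) ^ 3 := by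
  classical
  set φ : Literature.MathematicalPhysics.QuantumFieldTheory.Site 3 L → (Fin 3 → ℤ) := fun y i => (y i - x i).valMinAbs with hφ
  have hinj : Set.InjOn φ (Finset.univ.filter fun y : Literature.MathematicalPhysics.QuantumFieldTheory.Site 3 L =>
      (Finset.univ.sup fun i : Fin 3 => ((y i - x i).valMinAbs).natAbs) ≤ R : Finset _) := by
    intro y _ y' _ h
    funext i
    have hi : (y i - x i).valMinAbs = (y' i - x i).valMinAbs := congrFun h i
    have := ZMod.valMinAbs_inj.1 hi
    exact sub_left_injective this
  have hmaps : Set.MapsTo φ (Finset.univ.filter fun y : Literature.MathematicalPhysics.QuantumFieldTheory.Site 3 L =>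
      (Finset.univ.sup fun i : Fin 3 => ((y i - x i).valMinAbs).natAbs) ≤ R : Finset _)
      (Finset.Icc (fun _ : Fin 3 => -(R : ℤ)) (fun _ : Fin 3 => (R : ℤ)) : Finset (Fin 3 → ℤ)) := by
    intro y hy
    rw [Finset.coe_filter, Set.mem_setOf_eq] at hy
    rw [Finset.coe_Icc, Set.mem_Icc]
    have hyi : ∀ i, ((y i - x i).valMinAbs).natAbs ≤ R := fun i =>
      (Finset.le_sup (f := fun i : Fin 3 => ((y i - x i).valMinAbs).natAbs) (Finset.mem_univ i)).trans hy.2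
    constructor
    · intro i; have := hyi i; simp only [hφ]; omega
    · intro i; have := hyi i; simp only [hφ]; omega
  calc (Finset.univ.filter fun y : Literature.MathematicalPhysics.QuantumFieldTheory.Site 3 L =>
          (Finset.univ.sup fun i : Fin 3 => ((y i - x i).valMinAbs).natAbs) ≤ R).card
      ≤ (Finset.Icc (fun _ : Fin 3 => -(R : ℤ)) (fun _ : Fin 3 => (R : ℤ))).card := Finset.card_le_card_of_injOn φ hmaps hinj
    _ = (2 * R + 1) ^ 3 := by
        rw [Pi.card_Icc]
        simp only [Int.card_Icc, Finset.prod_const, Finset.card_univ, Fintype.card_fin]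
        have : ((R : ℤ) + 1 - -(R : ℤ)).toNat = 2 * R + 1 := by omega
        rw [this]

/-- Links are counted through their base points: `#{f : D(x, f) ≤ R} ≤ 3(2R+1)³`. [folklore] -/
theorem card_edge_torusBall_le (x : Literature.MathematicalPhysics.QuantumFieldTheory.Site 3 L) (R : ℕ) :
    (Finset.univ.filter fun f : Edge 3 L =>
        (Finset.univ.sup fun i : Fin 3 => ((f.1 i - x i).valMinAbs).natAbs) ≤ R).card ≤ 3 * (2 * R + 1) ^ 3 := by
  classical
  have h : (Finset.univ.filter fun f : Edge 3 L =>
        (Finset.univ.sup fun i : Fin 3 => ((f.1 i - x i).valMinAbs).natAbs) ≤ R) =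
      (Finset.univ.filter fun y : Literature.MathematicalPhysics.QuantumFieldTheory.Site 3 L =>
        (Finset.univ.sup fun i : Fin 3 => ((y i - x i).valMinAbs).natAbs) ≤ R) ×ˢ (Finset.univ : Finset (Fin 3)) := by
    ext f
    simp only [Finset.mem_filter, Finset.mem_univ, true_and, Finset.mem_product, and_true]
  rw [h, Finset.card_product, Finset.card_univ, Fintype.card_fin, mul_comm]
  exact Nat.mul_le_mul_left 3 (card_torusBall_le x R)

/-! ## §4. Volume-free exponential sums -/

/-- `(2d+1)³ ≤ 27^d`. [folklore] -/
theorem two_mul_add_one_pow_three_le (d : ℕ) : (2 * d + 1) ^ 3 ≤ 27 ^ d := by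
  have h : 2 * d + 1 ≤ 3 ^ d := by
    induction d with
    | zero => simp
    | succ n ih =>
      have h3 : 1 ≤ 3 ^ n := Nat.one_le_pow _ _ (by norm_num)
      calc 2 * (n + 1) + 1 = (2 * n + 1) + 2 := by ring
        _ ≤ 3 ^ n + 2 * 3 ^ n := by omega
        _ = 3 ^ (n + 1) := by ring
  calc (2 * d + 1) ^ 3 ≤ (3 ^ d) ^ 3 := Nat.pow_le_pow_left h 3
    _ = 27 ^ d := by rw [← pow_mul, mul_comm, pow_mul]; norm_num

/-- ★ **Volume-free exponential sum over the torus**: `Σ_y 54^{−D(x,y)} ≤ 2` for every `L` (the shell of radius `d` has at most `(2d+1)³ ≤ 27^d`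
points and `Σ_d 27^d 54^{−d} = Σ_d 2^{−d} ≤ 2`). [folklore] -/
theorem sum_pow_torusDist_le (x : Literature.MathematicalPhysics.QuantumFieldTheory.Site 3 L) :
    ∑ y : Literature.MathematicalPhysics.QuantumFieldTheory.Site 3 L,
        ((54 : ℝ)⁻¹) ^ (Finset.univ.sup fun i : Fin 3 => ((y i - x i).valMinAbs).natAbs) ≤ 2 := by
  classical
  set D : Literature.MathematicalPhysics.QuantumFieldTheory.Site 3 L → ℕ := fun y =>
    Finset.univ.sup fun i : Fin 3 => ((y i - x i).valMinAbs).natAbs with hD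
  -- group by the value of `D`
  set M : ℕ := Finset.univ.sup D with hM
  have hDle : ∀ y, D y ≤ M := fun y => Finset.le_sup (f := D) (Finset.mem_univ y)
  have hfib : ∑ y : Literature.MathematicalPhysics.QuantumFieldTheory.Site 3 L, ((54 : ℝ)⁻¹) ^ D y =
      ∑ d ∈ Finset.range (M + 1), ((Finset.univ.filter fun y => D y = d).card : ℝ) * ((54 : ℝ)⁻¹) ^ d := by
    rw [← Finset.sum_fiberwise_of_maps_to (s := Finset.univ) (t := Finset.range (M + 1)) (g := D)
      (fun y _ => Finset.mem_range.2 (Nat.lt_succ_of_le (hDle y)))]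
    refine Finset.sum_congr rfl fun d _ => ?_
    have : ∀ y ∈ Finset.univ.filter (fun y => D y = d), ((54 : ℝ)⁻¹) ^ D y = ((54 : ℝ)⁻¹) ^ d := fun y hy => by
      rw [(Finset.mem_filter.1 hy).2]
    rw [Finset.sum_congr rfl this, Finset.sum_const, nsmul_eq_mul]
  rw [hfib]
  -- shells are small
  have hshell : ∀ d, ((Finset.univ.filter fun y => D y = d).card : ℝ) ≤ (27 : ℝ) ^ d := by
    intro d
    have h1 : (Finset.univ.filter fun y => D y = d).card ≤ (Finset.univ.filter fun y => D y ≤ d).card := by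
      refine Finset.card_le_card fun y hy => ?_
      simp only [Finset.mem_filter, Finset.mem_univ, true_and] at hy ⊢
      exact hy.le
    have h2 := card_torusBall_le x d
    have h3 := two_mul_add_one_pow_three_le d
    have h4 : (Finset.univ.filter fun y => D y = d).card ≤ 27 ^ d := h1.trans (h2.trans h3)
    exact_mod_cast h4
  calc ∑ d ∈ Finset.range (M + 1), ((Finset.univ.filter fun y => D y = d).card : ℝ) * ((54 : ℝ)⁻¹) ^ d
      ≤ ∑ d ∈ Finset.range (M + 1), (27 : ℝ) ^ d * ((54 : ℝ)⁻¹) ^ d :=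
        Finset.sum_le_sum fun d _ => mul_le_mul_of_nonneg_right (hshell d) (by positivity)
    _ = ∑ d ∈ Finset.range (M + 1), (1 / (2 : ℝ)) ^ d := by
        refine Finset.sum_congr rfl fun d _ => ?_
        rw [← mul_pow]; norm_num
    _ ≤ 2 := sum_geometric_two_le _

/-- `Σ_f 54^{−D(x,f)} ≤ 6` over links (three directions per base point). [folklore] -/
theorem sum_edge_pow_torusDist_le (x : Literature.MathematicalPhysics.QuantumFieldTheory.Site 3 L) :
    ∑ f : Edge 3 L, ((54 : ℝ)⁻¹) ^ (Finset.univ.sup fun i : Fin 3 => ((f.1 i - x i).valMinAbs).natAbs) ≤ 6 := by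
  rw [Fintype.sum_prod_type]
  simp only [Finset.sum_const, Finset.card_univ, Fintype.card_fin, nsmul_eq_mul, Nat.cast_ofNat]
  have h := sum_pow_torusDist_le x
  rw [← Finset.mul_sum]
  linarith

/-- ★★ **Inside / outside the light cone**: for `a, B ≥ 0`, every centre `x` and every radius `R`,
`Σ_f min(a·108^{−D(x,f)}, B) ≤ 3(2R+1)³·B + 6a·2^{−(R+1)}` (links within sup-distance `R` of `x` cost `B` each; outside, `108^{−D} ≤ 2^{−(R+1)}·54^{−D}`
and the volume-free sum). [folklore] -/
theorem sum_edge_min_le (x : Literature.MathematicalPhysics.QuantumFieldTheory.Site 3 L) {a B : ℝ} (ha : 0 ≤ a) (hB : 0 ≤ B) (R : ℕ) :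
    ∑ f : Edge 3 L, min (a * ((108 : ℝ)⁻¹) ^ (Finset.univ.sup fun i : Fin 3 => ((f.1 i - x i).valMinAbs).natAbs)) B ≤
      3 * (2 * R + 1) ^ 3 * B + 6 * a * ((2 : ℝ)⁻¹) ^ (R + 1) := by
  classical
  set D : Edge 3 L → ℕ := fun f => Finset.univ.sup fun i : Fin 3 => ((f.1 i - x i).valMinAbs).natAbs with hD
  -- pointwise: inside the ball use `B`, outside use the weight
  have hpt : ∀ f : Edge 3 L, min (a * ((108 : ℝ)⁻¹) ^ D f) B ≤
      (if D f ≤ R then B else 0) + a * ((2 : ℝ)⁻¹) ^ (R + 1) * ((54 : ℝ)⁻¹) ^ D f := by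
    intro f
    by_cases h : D f ≤ R
    · rw [if_pos h]
      exact (min_le_right _ _).trans (le_add_of_nonneg_right (by positivity))
    · rw [if_neg h, zero_add]
      refine (min_le_left _ _).trans ?_
      have hR : R + 1 ≤ D f := by omega
      have hsplit : ((108 : ℝ)⁻¹) ^ D f = ((2 : ℝ)⁻¹) ^ D f * ((54 : ℝ)⁻¹) ^ D f := by rw [← mul_pow]; norm_num
      rw [hsplit, ← mul_assoc]
      refine mul_le_mul_of_nonneg_right (mul_le_mul_of_nonneg_left ?_ ha) (by positivity)
      exact pow_le_pow_of_le_one (by norm_num) (by norm_num) hR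
  calc ∑ f : Edge 3 L, min (a * ((108 : ℝ)⁻¹) ^ D f) B
      ≤ ∑ f : Edge 3 L, ((if D f ≤ R then B else 0) + a * ((2 : ℝ)⁻¹) ^ (R + 1) * ((54 : ℝ)⁻¹) ^ D f) :=
        Finset.sum_le_sum fun f _ => hpt f
    _ = (Finset.univ.filter fun f : Edge 3 L => D f ≤ R).card * B +
          a * ((2 : ℝ)⁻¹) ^ (R + 1) * ∑ f : Edge 3 L, ((54 : ℝ)⁻¹) ^ D f := by
        rw [Finset.sum_add_distrib, Finset.sum_ite, Finset.sum_const_zero, add_zero, Finset.sum_const, nsmul_eq_mul,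
          Finset.mul_sum]
    _ ≤ (3 * (2 * R + 1) ^ 3 : ℕ) * B + a * ((2 : ℝ)⁻¹) ^ (R + 1) * 6 := by
        have h1 : ((Finset.univ.filter fun f : Edge 3 L => D f ≤ R).card : ℝ) ≤ ((3 * (2 * R + 1) ^ 3 : ℕ) : ℝ) := by
          exact_mod_cast card_edge_torusBall_le x R
        have h2 := sum_edge_pow_torusDist_le x
        gcongr
    _ = 3 * (2 * R + 1) ^ 3 * B + 6 * a * ((2 : ℝ)⁻¹) ^ (R + 1) := by push_cast; ring

/-- ★ **Splitting a minimum over a sum**: `min(Σ_e u_e, B) ≤ Σ_e min(u_e, B)` for `u, B ≥ 0`. [folklore] -/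
theorem min_sum_le_sum_min {ι : Type*} (s : Finset ι) (u : ι → ℝ) (hu : ∀ i ∈ s, 0 ≤ u i) {B : ℝ} (hB : 0 ≤ B) :
    min (∑ i ∈ s, u i) B ≤ ∑ i ∈ s, min (u i) B := by
  classical
  induction s using Finset.induction_on with
  | empty => simp [hB]
  | @insert a s ha ih =>
    have hu' : ∀ i ∈ s, 0 ≤ u i := fun i hi => hu i (Finset.mem_insert_of_mem hi)
    have hua : 0 ≤ u a := hu a (Finset.mem_insert_self a s)
    rw [Finset.sum_insert ha, Finset.sum_insert ha]
    have hs0 : 0 ≤ ∑ i ∈ s, u i := Finset.sum_nonneg hu'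
    have hm0 : 0 ≤ ∑ i ∈ s, min (u i) B := Finset.sum_nonneg fun i hi => le_min (hu' i hi) hB
    have h1 : min (u a + ∑ i ∈ s, u i) B ≤ min (u a) B + min (∑ i ∈ s, u i) B := by
      rcases le_total (u a) B with h | h
      · rw [min_eq_left h]
        rcases le_total (∑ i ∈ s, u i) B with h' | h'
        · rw [min_eq_left h']; exact min_le_left _ _
        · rw [min_eq_right h']; exact (min_le_right _ _).trans (by linarith)
      · rw [min_eq_right h]; exact (min_le_right _ _).trans (by linarith [le_min hs0 hB])
    exact h1.trans (add_le_add le_rfl (ih hu'))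

end Summit.QuantumFields.YangMills.Theorems.ColdStartUniversality.LiebRobinson
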